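import Summits.QuantumAdvantage.QuantumAdvantage.Theorems.WalkQuotient

/-!
# The THREE-CHARGE IDENTITY, the charge-averaged `2/3` law and the odd-one-out form T′ (planner qa-qnc0-p2 g21, ROUND-21 (p2)
# §2; ask P2-21 (a)+(b); `--supports` crux `ManyReadersSqrtOdd` stmt-QuantumAdvantage-23109)

VERBATIM port (part 2/2) of `HOME/qa-qnc0-p2/line21/Sketch21.lean` (authored AND proved by the planner seat qn-p2 g21, farm rc 0,
0 sorry; landed by qn-prover-3 g13); NEW here are only the last theorem `beatingTwoThirdsPredicts_holds` (ask P2-21 (b)) and one-line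
docstrings of auxiliary lemmas.  Contents:

* **`threeCharge_holds : ThreeCharge`** (Lemma T): for EVERY strategy `y` and input `u`, `WIN_c ⊕ WIN_{c+1} = WIN_{c+2}` (a fired
  cut is live for exactly two of the three charges; `chargeSum_card`).  Corollaries: `notAllThree_holds`, `chargeSumTwoThirds_holds`
  (charge-summed count `≤ 2·2ⁿ`), **`minChargeTwoThirds_holds`** (some charge wins on `≤ (2/3)·2ⁿ` inputs — the value `2/3` of
  conjecture R5♯ is forced ON AVERAGE over the charge for arbitrary, even non-polynomial, strategies).
* **`oddOneOutForm_holds : OddOneOutForm`** (Lemma T′): `WIN_c(u) ⟺ nae₀(u) ∧ wt u ≢ −c − oddOneOut(u) (mod 3)` — the total weight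
  enters the game ONLY as the residue to be avoided by the W-free statistic `oddOneOut` (`classParity`, `liveCount_split`, 24
  finite cases `oddOneOut_cases`).
* **`beatingTwoThirdsPredicts_holds : BeatingTwoThirdsPredicts`** (NEW, S): winning `≥ (2/3 + ε)·2ⁿ` inputs at charge `c` yields
  `j ∈ {1,2}` with `#{u : wt u ≡ j + 2c + 2·oddOneOut y u (3)} ≥ (1/3 + ε/2)·2ⁿ` — by T′ the win set lies in the disjoint union of
  the two residue events, so one of them has at least half the wins: beating `2/3` IS predicting `|u| mod 3`.
WHAT THIS IS NOT: no bound on the dense residual (R5 / (W2)); instrument for cruxes 23109/23029; separation NOT moved.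
-/

open Finset

namespace Summit.QuantumAdvantage.AdviceFreeQNC0

namespace Coset21

/-- **Three-charge identity** (support, S): `WIN_c ⊕ WIN_{c+1} = WIN_{c+2}` pointwise, for every strategy. -/
def ThreeCharge : Prop :=
  ∀ (n c : ℕ) (y : Fin (n + 1) → (Fin n → Bool) → Bool) (u : Fin n → Bool),
    Bool.xor (ringWinU c y u) (ringWinU (c + 1) y u) = ringWinU (c + 2) y u

/-! #### Proof of the three-charge identity -/

/-- Among the three charges, a cut with walk value `v` is live for exactly two. -/
theorem two_of_three (v : ℕ) : (∑ j ∈ Finset.range 3, if (v + j) % 3 ≠ 0 then 1 else 0) = 2 := by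
  simp only [Finset.sum_range_succ, Finset.sum_range_zero, zero_add]
  split_ifs <;> omega

/-- Charge-summed count of live fired cuts `= 2 · #fired`. -/
theorem chargeSum_card (n c : ℕ) (y : Fin (n + 1) → (Fin n → Bool) → Bool) (u : Fin n → Bool) :
    (∑ j ∈ Finset.range 3,
        (univ.filter fun g : Fin (n + 1) => y g u = true ∧ (c + j + g.val + walkExp u g.val) % 3 ≠ 0).card)
      = 2 * (univ.filter fun g : Fin (n + 1) => y g u = true).card := by
  have step : ∀ j : ℕ,
      (univ.filter fun g : Fin (n + 1) => y g u = true ∧ (c + j + g.val + walkExp u g.val) % 3 ≠ 0).card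
        = ∑ g ∈ univ.filter (fun g : Fin (n + 1) => y g u = true),
            (if (c + g.val + walkExp u g.val + j) % 3 ≠ 0 then 1 else 0) := by
    intro j
    rw [← Finset.filter_filter, Finset.card_filter]
    apply Finset.sum_congr rfl
    intro g _
    have hcomm : c + j + g.val + walkExp u g.val = c + g.val + walkExp u g.val + j := by ring
    rw [hcomm]
  rw [Finset.sum_congr rfl fun j _ => step j, Finset.sum_comm]
  simp_rw [two_of_three]
  rw [Finset.sum_const, smul_eq_mul, mul_comm]

/-- Parity bookkeeping: `A + B + C` even forces `par A ⊕ par B = par C`. -/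
theorem xor_decide_of_sum {A B C F : ℕ} (h : A + B + C = 2 * F) :
    Bool.xor (decide (A % 2 = 1)) (decide (B % 2 = 1)) = decide (C % 2 = 1) := by
  rcases Nat.mod_two_eq_zero_or_one A with ha | ha <;> rcases Nat.mod_two_eq_zero_or_one B with hb | hb <;>
    rcases Nat.mod_two_eq_zero_or_one C with hc | hc <;> simp [ha, hb, hc] <;> omega

/-- **The three-charge identity holds** (Lemma T of ROUND-21 §2). -/
theorem threeCharge_holds : ThreeCharge := by
  intro n c y u
  have hsum := chargeSum_card n c y u
  simp only [Finset.sum_range_succ, Finset.sum_range_zero, zero_add, add_zero] at hsum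
  exact xor_decide_of_sum hsum

/-- No input is won at all three charges. -/
def NotAllThree : Prop :=
  ∀ (n c : ℕ) (y : Fin (n + 1) → (Fin n → Bool) → Bool) (u : Fin n → Bool),
    ¬ (ringWinU c y u = true ∧ ringWinU (c + 1) y u = true ∧ ringWinU (c + 2) y u = true)

/-- `ThreeCharge → NotAllThree`. -/
theorem notAllThree_of_threeCharge (h : ThreeCharge) : NotAllThree := by
  intro n c y u ⟨h0, h1, h2⟩
  have h3 := h n c y u
  rw [h0, h1, h2] at h3
  exact Bool.noConfusion h3

/-- Charge-summed win count `≤ 2·2ⁿ` for every strategy. -/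
def ChargeSumTwoThirds : Prop :=
  ∀ (n c : ℕ) (y : Fin (n + 1) → (Fin n → Bool) → Bool),
    (∑ j ∈ Finset.range 3, (univ.filter fun u : Fin n → Bool => ringWinU (c + j) y u = true).card) ≤ 2 * 2 ^ n

/-- `NotAllThree → ChargeSumTwoThirds` (sum the pointwise bound `≤ 2` over the inputs). -/
theorem chargeSum_of_notAllThree (h : NotAllThree) : ChargeSumTwoThirds := by
  intro n c y
  have key : ∀ u : Fin n → Bool,
      (∑ j ∈ Finset.range 3, if ringWinU (c + j) y u = true then 1 else 0) ≤ 2 := by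
    intro u
    have hu := h n c y u
    simp only [Finset.sum_range_succ, Finset.sum_range_zero, zero_add, Nat.add_zero]
    rcases Bool.eq_false_or_eq_true (ringWinU c y u) with h0 | h0 <;>
    rcases Bool.eq_false_or_eq_true (ringWinU (c + 1) y u) with h1 | h1 <;>
    rcases Bool.eq_false_or_eq_true (ringWinU (c + 2) y u) with h2 | h2 <;>
    simp_all
  calc (∑ j ∈ Finset.range 3, (univ.filter fun u : Fin n → Bool => ringWinU (c + j) y u = true).card)
      = ∑ j ∈ Finset.range 3, ∑ u : Fin n → Bool, (if ringWinU (c + j) y u = true then 1 else 0) := by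
        apply Finset.sum_congr rfl; intro j _; rw [Finset.card_filter]
    _ = ∑ u : Fin n → Bool, ∑ j ∈ Finset.range 3, (if ringWinU (c + j) y u = true then 1 else 0) :=
        Finset.sum_comm
    _ ≤ ∑ _u : Fin n → Bool, 2 := Finset.sum_le_sum fun u _ => key u
    _ = 2 * 2 ^ n := by simp [Finset.card_univ, Fintype.card_bool, Fintype.card_fin, mul_comm]

/-- Some charge wins on at most `(2/3)·2ⁿ` inputs (for EVERY strategy, no complexity hypothesis). -/
def MinChargeTwoThirds : Prop :=
  ∀ (n c : ℕ) (y : Fin (n + 1) → (Fin n → Bool) → Bool),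
    ∃ j < 3, ((univ.filter fun u : Fin n → Bool => ringWinU (c + j) y u = true).card : ℝ) ≤ (2 / 3 : ℝ) * (2 : ℝ) ^ n

/-- `ChargeSumTwoThirds → MinChargeTwoThirds` (pigeonhole over the three charges). -/
theorem minCharge_of_chargeSum (h : ChargeSumTwoThirds) : MinChargeTwoThirds := by
  intro n c y
  by_contra hcon
  push Not at hcon
  have hsum := h n c y
  have hlt : ∀ j ∈ Finset.range 3,
      (2 / 3 : ℝ) * (2 : ℝ) ^ n < ((univ.filter fun u : Fin n → Bool => ringWinU (c + j) y u = true).card : ℝ) :=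
    fun j hj => hcon j (Finset.mem_range.mp hj)
  have h3 : (∑ _j ∈ Finset.range 3, (2 / 3 : ℝ) * (2 : ℝ) ^ n)
      < ∑ j ∈ Finset.range 3, ((univ.filter fun u : Fin n → Bool => ringWinU (c + j) y u = true).card : ℝ) :=
    Finset.sum_lt_sum_of_nonempty (by simp) hlt
  have hcast : (∑ j ∈ Finset.range 3, ((univ.filter fun u : Fin n → Bool => ringWinU (c + j) y u = true).card : ℝ))
      ≤ (2 * 2 ^ n : ℕ) := by exact_mod_cast hsum
  simp only [Finset.sum_const, Finset.card_range, nsmul_eq_mul] at h3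
  push_cast at hcast h3
  linarith

/-- The chain in one line: the three-charge identity already forces the charge-averaged `2/3` law. -/
theorem minCharge_of_threeCharge (h : ThreeCharge) : MinChargeTwoThirds :=
  minCharge_of_chargeSum (chargeSum_of_notAllThree (notAllThree_of_threeCharge h))

/-- **Unconditional:** for EVERY strategy (any complexity) and every `n, c`, some charge `c + j`, `j < 3`, wins on at most
`(2/3)·2ⁿ` inputs; in particular no strategy wins more than `2/3` of the inputs at all three charges simultaneously. -/
theorem minChargeTwoThirds_holds : MinChargeTwoThirds := minCharge_of_threeCharge threeCharge_holds

/-- **No input is won at all three charges** (unconditional). -/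
theorem notAllThree_holds : NotAllThree := notAllThree_of_threeCharge threeCharge_holds

/-- **Charge-summed win count `≤ 2·2ⁿ`** (unconditional). -/
theorem chargeSumTwoThirds_holds : ChargeSumTwoThirds := chargeSum_of_notAllThree notAllThree_holds

/-! #### The W-free odd-one-out form (Lemma T′ of ROUND-21 §2; statement only, checked numerically n ≤ 9) -/

/-- Parity of the number of FIRED cuts whose prefix class `(g + wtPrefix u g) mod 3` is `b` (the total weight `wt u` is NOT used). -/
def classParity {n : ℕ} (y : Fin (n + 1) → (Fin n → Bool) → Bool) (u : Fin n → Bool) (b : ℕ) : ℕ :=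
  (univ.filter fun g : Fin (n + 1) => y g u = true ∧ (g.val + wtPrefix u g.val) % 3 = b % 3).card % 2

/-- "not all equal": the three class parities do not coincide. -/
def nae₀ {n : ℕ} (y : Fin (n + 1) → (Fin n → Bool) → Bool) (u : Fin n → Bool) : Prop :=
  ¬ (classParity y u 0 = classParity y u 1 ∧ classParity y u 1 = classParity y u 2)

/-- the odd one out among the three class parities (meaningful under `nae₀`). -/
def oddOneOut {n : ℕ} (y : Fin (n + 1) → (Fin n → Bool) → Bool) (u : Fin n → Bool) : ℕ :=
  if classParity y u 0 ≠ classParity y u 1 ∧ classParity y u 0 ≠ classParity y u 2 then 0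
  else if classParity y u 1 ≠ classParity y u 0 ∧ classParity y u 1 ≠ classParity y u 2 then 1 else 2

/-- **Lemma T′ (support, S).**  `WIN_c(u) ⟺ nae₀(u) ∧ wt u ≢ −c − b*₀(u) (mod 3)`: the total weight enters the game ONLY as the residue
to be avoided by the W-free statistic `oddOneOut`.  Corollary (memo §2): a strategy winning `≥ 2/3 + ε` of the inputs at charge `c` yields
`j ∈ {1,2}` with `Pr_u[wt u ≡ j − c − oddOneOut y u (mod 3)] ≥ 1/3 + ε/2` — beating `2/3` IS predicting `|u| mod 3`. -/
def OddOneOutForm : Prop :=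
  ∀ (n c : ℕ) (y : Fin (n + 1) → (Fin n → Bool) → Bool) (u : Fin n → Bool),
    ringWinU c y u = true ↔ (nae₀ y u ∧ (wt u + c + oddOneOut y u) % 3 ≠ 0)

/-! #### Proof of the odd-one-out form -/

/-- live fired cuts = fired cuts in the two prefix classes other than `t ≡ −c − W`. -/
theorem liveCount_split (n c : ℕ) (y : Fin (n + 1) → (Fin n → Bool) → Bool) (u : Fin n → Bool) (t : ℕ)
    (ht : (t + c + wt u) % 3 = 0) :
    (univ.filter fun g : Fin (n + 1) => y g u = true ∧ (c + g.val + walkExp u g.val) % 3 ≠ 0).card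
      = (univ.filter fun g : Fin (n + 1) => y g u = true ∧ (g.val + wtPrefix u g.val) % 3 = (t + 1) % 3).card
        + (univ.filter fun g : Fin (n + 1) => y g u = true ∧ (g.val + wtPrefix u g.val) % 3 = (t + 2) % 3).card := by
  rw [← Finset.filter_filter, ← Finset.filter_filter, ← Finset.filter_filter,
    Finset.card_filter, Finset.card_filter, Finset.card_filter, ← Finset.sum_add_distrib]
  apply Finset.sum_congr rfl
  intro g _
  simp only [walkExp]
  split_ifs <;> omega

/-- the finite bookkeeping behind T′: parities `a0 a1 a2` of the three classes, live classes = the two other than `t`. -/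
theorem oddOneOut_cases (A0 A1 A2 W c : ℕ) :
    ((c + W) % 3 = 0 →
      ((A1 + A2) % 2 = 1 ↔
        (¬ (A0 % 2 = A1 % 2 ∧ A1 % 2 = A2 % 2) ∧
          (W + c + (if A0 % 2 ≠ A1 % 2 ∧ A0 % 2 ≠ A2 % 2 then 0
            else if A1 % 2 ≠ A0 % 2 ∧ A1 % 2 ≠ A2 % 2 then 1 else 2)) % 3 ≠ 0))) ∧
    ((c + W) % 3 = 1 →
      ((A0 + A1) % 2 = 1 ↔
        (¬ (A0 % 2 = A1 % 2 ∧ A1 % 2 = A2 % 2) ∧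
          (W + c + (if A0 % 2 ≠ A1 % 2 ∧ A0 % 2 ≠ A2 % 2 then 0
            else if A1 % 2 ≠ A0 % 2 ∧ A1 % 2 ≠ A2 % 2 then 1 else 2)) % 3 ≠ 0))) ∧
    ((c + W) % 3 = 2 →
      ((A2 + A0) % 2 = 1 ↔
        (¬ (A0 % 2 = A1 % 2 ∧ A1 % 2 = A2 % 2) ∧
          (W + c + (if A0 % 2 ≠ A1 % 2 ∧ A0 % 2 ≠ A2 % 2 then 0
            else if A1 % 2 ≠ A0 % 2 ∧ A1 % 2 ≠ A2 % 2 then 1 else 2)) % 3 ≠ 0))) := by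
  rcases Nat.mod_two_eq_zero_or_one A0 with h0 | h0 <;> rcases Nat.mod_two_eq_zero_or_one A1 with h1 | h1 <;>
    rcases Nat.mod_two_eq_zero_or_one A2 with h2 | h2 <;> simp [h0, h1, h2] <;> omega

/-- **Lemma T′ holds.** -/
theorem oddOneOutForm_holds : OddOneOutForm := by
  intro n c y u
  have hc := oddOneOut_cases
    ((univ.filter fun g : Fin (n + 1) => y g u = true ∧ (g.val + wtPrefix u g.val) % 3 = 0).card)
    ((univ.filter fun g : Fin (n + 1) => y g u = true ∧ (g.val + wtPrefix u g.val) % 3 = 1).card)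
    ((univ.filter fun g : Fin (n + 1) => y g u = true ∧ (g.val + wtPrefix u g.val) % 3 = 2).card)
    (wt u) c
  unfold ringWinU nae₀ oddOneOut classParity
  simp only [Nat.reduceMod, decide_eq_true_eq]
  have h3 : (c + wt u) % 3 = 0 ∨ (c + wt u) % 3 = 1 ∨ (c + wt u) % 3 = 2 := by omega
  rcases h3 with h | h | h
  · rw [liveCount_split n c y u 0 (by omega)]
    exact hc.1 h
  · rw [liveCount_split n c y u 2 (by omega)]
    exact hc.2.1 h
  · rw [liveCount_split n c y u 1 (by omega)]
    exact hc.2.2 h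

/-- The prediction corollary as a statement (support, S): winning `> (2/3 + ε)·2ⁿ` inputs forces a `(1/3 + ε/2)`-predictor of `wt u mod 3`. -/
def BeatingTwoThirdsPredicts : Prop :=
  ∀ (n c : ℕ) (y : Fin (n + 1) → (Fin n → Bool) → Bool) (ε : ℝ),
    ((2 / 3 : ℝ) + ε) * (2 : ℝ) ^ n ≤ ((univ.filter fun u : Fin n → Bool => ringWinU c y u = true).card : ℝ) →
    ∃ j : ℕ, 0 < j ∧ j < 3 ∧
      ((1 / 3 : ℝ) + ε / 2) * (2 : ℝ) ^ n ≤
        ((univ.filter fun u : Fin n → Bool => (wt u) % 3 = (j + 2 * c + 2 * oddOneOut y u) % 3).card : ℝ)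


/-! #### Proof of the prediction corollary (qn-prover-3 g13; ask P2-21 (b)) -/

/-- **`BeatingTwoThirdsPredicts` holds**: by T′ every won input `u` has `wt u ≡ j + 2c + 2·oddOneOut y u (mod 3)` for `j = 1` or
`j = 2`; the two events are disjoint, so one of them carries at least half of the `≥ (2/3 + ε)·2ⁿ` wins. -/
theorem beatingTwoThirdsPredicts_holds : BeatingTwoThirdsPredicts := by
  intro n c y ε hwin
  classical
  have hsub : (univ.filter fun u : Fin n → Bool => ringWinU c y u = true) ⊆
      (univ.filter fun u : Fin n → Bool => (wt u) % 3 = (1 + 2 * c + 2 * oddOneOut y u) % 3) ∪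
        (univ.filter fun u : Fin n → Bool => (wt u) % 3 = (2 + 2 * c + 2 * oddOneOut y u) % 3) := by
    intro u hu
    rw [mem_filter] at hu
    have h := ((oddOneOutForm_holds n c y u).1 hu.2).2
    rw [mem_union, mem_filter, mem_filter]
    simp only [mem_univ, true_and]
    omega
  have hcard := (card_le_card hsub).trans (card_union_le _ _)
  have hcardR : ((univ.filter fun u : Fin n → Bool => ringWinU c y u = true).card : ℝ) ≤
      ((univ.filter fun u : Fin n → Bool => (wt u) % 3 = (1 + 2 * c + 2 * oddOneOut y u) % 3).card : ℝ) +
        ((univ.filter fun u : Fin n → Bool => (wt u) % 3 = (2 + 2 * c + 2 * oddOneOut y u) % 3).card : ℝ) := by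
    exact_mod_cast hcard
  by_contra hcon
  push Not at hcon
  have h1 := hcon 1 Nat.one_pos (by norm_num)
  have h2 := hcon 2 (by norm_num) (by norm_num)
  linarith

end Coset21

end Summit.QuantumAdvantage.AdviceFreeQNC0
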